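import Mathlib
import HarnessLib
import Summits.Ventures.LatticeQCDFlow.Scoring.SplitChainFreshPairMoments
import Summits.Ventures.LatticeQCDFlow.Exactness.NCMCGeneralSpaceDoeblinPowerDecorrelation

/-!
# Lag products along a chain with a Doeblin POWER, from any start: `E_{μ₀}[(Σ_{t<n} f̄(X_{s+t}))²] ≤ (2C)²(2 + 4m/ε) n`, the bias `|E_{μ₀} g(X_t)g(X_{t+k}) − C_g(k)| ≤ 2 C_g² (1 − ε)^{⌊t/m⌋}`, and the covariance envelope `|E_{μ₀} B_s B_t| ≤ 4 C_g⁴ (1 − ε)^{⌊(|t−s|−k)/m⌋}` of the centred lag products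

HONEST FRAMING: exact (Metropolis-corrected) sampling algorithms for lattice gauge theory;
figures of merit are autocorrelation/cost numbers at stated couplings and volumes; no
continuum-physics claim.

Venture `LatticeQCDFlow` (cell pub-lqcd), topic `Exactness`; FANOUT row 13 (`eng-snf`, GEN-20).
NEW WORK of the cell, not a published result; no definition is introduced; nothing is cited as a
fact (the `L²`-consistency of empirical autocovariances of uniformly mixing sequences — Anderson 1971
Ch. 8, Ibragimov–Linnik 1971 — NAMED ONLY).  Setting: `κ` a Markov kernel on `S` with invariant
probability `π` and an `m`-step Doeblin minorisation `(nHit κ m)(x, ·) ≥ ε ν` by ANY probability law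
`ν` (`0 < ε ≤ 1`, `0 < m`, `e = ε.toReal`) — the certificate shape of the engine's NCMC lane (`m = 2`,
GEN-18) and of every composite exact sampler of the cell; `P_{μ₀}` the chain's path law from ANY
initial law.  For a bounded measurable `g` (`|g| ≤ C_g`) the LAG PRODUCTS `A_t = g(X_t) g(X_{t+k})` have
population value `C_g(k) = Scoring.autocov κ π g k = ∫ g · (kop κ)^[k] g dπ` (`= E_π[g(X_0) g(X_k)]`);
the KNOWN-MEAN lag sum is `S⁰_N(k) = Σ_{t<N−k} A_t` (scorer A's `Scoring.lagSum (g ∘ X) N k`).  From the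
decorrelation lemmas of `NCMCGeneralSpaceDoeblinPowerDecorrelation.lean`: the bias of `A_t` decays like
`(1 − e)^{⌊t/m⌋}`, the centred products `B_t = A_t − E A_t` have `|E B_s B_t| ≤ 4 C_g⁴ (1 − e)^{⌊(|t−s|−k)/m⌋}`
(truncated subtraction: the crude bound `4 C_g⁴` inside the overlap window `|t − s| < k`, geometric
decorrelation beyond it) — UNIFORMLY IN THE INITIAL LAW.  These are the inputs of the variance of the
lag sum (`NCMCGeneralSpaceLagSumVariance.lean`) and of the consistency of scorer A's Γ-method estimator
(`NCMCGeneralSpaceGammaMethodConsistency.lean`).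

## Content (hypotheses as above; every `μ₀`)

* `abs_chain_centred_pair_le_of_nHit` — `|E_{μ₀}[f̄(X_i) f̄(X_j)]| ≤ 2 (2C)² (1 − e)^{⌊(j−i)/m⌋}` (`i ≤ j`,
  `f̄ = f − πf`, `|f| ≤ C`); **`chain_sq_sum_centred_le_of_nHit`** —
  `E_{μ₀}[(Σ_{t<n} (f(X_{s+t}) − πf))²] ≤ (2C)² (2 + 4m/e) n`, every block position `s`.
* **`abs_chain_lagProduct_sub_autocov_le_of_nHit`** — `|E_{μ₀}[g(X_t) g(X_{t+k})] − C_g(k)| ≤ 2 C_g² (1 − e)^{⌊t/m⌋}`.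
* **`abs_chain_lagProduct_cov_le_of_nHit`** — for ALL `s, t`:
  `|E_{μ₀}[B_s B_t]| ≤ 4 C_g⁴ (1 − e)^{⌊(dist(s,t) − k)/m⌋}` (`B_t = A_t − E_{μ₀} A_t`, natural subtraction).

The variance of the lag sum and the mean-square error of `S⁰_N(k)/(N − k)` follow in
`NCMCGeneralSpaceLagSumVariance.lean`.

NOT CLAIMED: sharp constants; unbounded observables; anything about a concrete sampler's `ε`.
-/

namespace Summit.Ventures.LatticeQCDFlow.Exactness.GeneralNCMC

open MeasureTheory ProbabilityTheory Set Filter Finset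
open scoped ENNReal Topology

variable {S : Type*} [MeasurableSpace S]

/-! ## The second moment of a centred block sum from any start -/

section BlockSum

variable {κ : Kernel S S} [IsMarkovKernel κ] {ν : Measure S} [IsProbabilityMeasure ν] {ε : ℝ≥0∞}
  {π : Measure S} [IsProbabilityMeasure π] {m : ℕ} (μ₀ : Measure S) [IsProbabilityMeasure μ₀]

/-- **Two-time products of a centred observable from any start**: for `f̄ = f − πf` (`|f| ≤ C`) and
`i ≤ j`: `|E_{μ₀}[f̄(X_i) f̄(X_j)]| ≤ 2 (2C)² (1 − ε)^{⌊(j−i)/m⌋}`. -/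
theorem abs_chain_centred_pair_le_of_nHit
    (hmin : ∀ x {B : Set S}, MeasurableSet B → ε * ν B ≤ nHit κ m x B) (hε1 : ε ≤ 1)
    (hπ : Kernel.Invariant κ π) {f : S → ℝ} (hf : Measurable f) {C : ℝ} (hC : ∀ x, |f x| ≤ C)
    {i j : ℕ} (hij : i ≤ j) :
    |∫ x, (f (x i) - ∫ z, f z ∂π) * (f (x j) - ∫ z, f z ∂π)
        ∂(Kernel.trajMeasure (X := fun _ : ℕ => S) μ₀
        (fun n : ℕ => κ.comap (fun h : (i : ↥(Finset.Iic n)) → S => h ⟨n, Finset.mem_Iic.2 le_rfl⟩)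
          (measurable_pi_apply _)))| ≤ 2 * (2 * C) ^ 2 * (1 - ε.toReal) ^ ((j - i) / m) := by
  set P := Kernel.trajMeasure (X := fun _ : ℕ => S) μ₀
      (fun n : ℕ => κ.comap (fun h : (i : ↥(Finset.Iic n)) → S => h ⟨n, Finset.mem_Iic.2 le_rfl⟩)
        (measurable_pi_apply _)) with hP
  obtain ⟨hfb, hCfb, hfb0⟩ := Scoring.centred_observable_bounds π hf hC
  have hC0 : 0 ≤ 2 * C := by
    have := (abs_nonneg _).trans (hCfb (Classical.choice (nonempty_of_isProbabilityMeasure μ₀)))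
    linarith
  obtain ⟨w, rfl⟩ := Nat.exists_eq_add_of_le hij
  have hG : Measurable fun x : ℕ → S => f (x i) - ∫ z, f z ∂π := hfb.comp (measurable_pi_apply _)
  have hGd : DependsOn (fun x : ℕ → S => f (x i) - ∫ z, f z ∂π) (Set.Iic i) := by
    intro x y hxy
    simp only [hxy i (Set.mem_Iic.2 le_rfl)]
  have h := chain_dependsOn_centredFuture_le_of_nHit μ₀ hmin hε1 hπ i w hG hGd (fun x => hCfb _)
    hfb hCfb
  rw [← hP] at h
  rw [hfb0, Nat.add_sub_cancel_left] at *
  simp only [sub_zero] at h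
  refine h.trans ?_
  have hI : ∫ x, |f (x i) - ∫ z, f z ∂π| ∂P ≤ 2 * C := by
    calc ∫ x, |f (x i) - ∫ z, f z ∂π| ∂P = ‖∫ x, |f (x i) - ∫ z, f z ∂π| ∂P‖ := by
          rw [Real.norm_eq_abs, abs_of_nonneg (integral_nonneg fun x => abs_nonneg _)]
      _ ≤ 2 * C * P.real univ := norm_integral_le_of_norm_le_const (Eventually.of_forall fun x => by
          rw [Real.norm_eq_abs, abs_abs]; exact hCfb _)
      _ = 2 * C := by rw [probReal_univ, mul_one]
  have hr0 : 0 ≤ 1 - ε.toReal :=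
    sub_nonneg.2 (ENNReal.toReal_le_of_le_ofReal zero_le_one (by simpa using hε1))
  calc 2 * (2 * C) * (1 - ε.toReal) ^ (w / m) * ∫ x, |f (x i) - ∫ z, f z ∂π| ∂P
      ≤ 2 * (2 * C) * (1 - ε.toReal) ^ (w / m) * (2 * C) :=
        mul_le_mul_of_nonneg_left hI (by positivity)
    _ = 2 * (2 * C) ^ 2 * (1 - ε.toReal) ^ (w / m) := by ring

/-- **SECOND MOMENT OF A CENTRED BLOCK SUM FROM ANY START, ANY POSITION**: `(nHit κ m)(x, ·) ≥ ε ν`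
(`0 < ε ≤ 1`, `0 < m`), `π` invariant, `|f| ≤ C`: for every initial law `μ₀`, every `s` and `n`,
`E_{μ₀}[(Σ_{t<n} (f(X_{s+t}) − πf))²] ≤ (2C)² (2 + 4m/ε) n`. -/
theorem chain_sq_sum_centred_le_of_nHit
    (hmin : ∀ x {B : Set S}, MeasurableSet B → ε * ν B ≤ nHit κ m x B) (hε0 : 0 < ε) (hε1 : ε ≤ 1)
    (hm : 0 < m) (hπ : Kernel.Invariant κ π) {f : S → ℝ} (hf : Measurable f) {C : ℝ}
    (hC : ∀ x, |f x| ≤ C) (s n : ℕ) :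
    ∫ x, (∑ t ∈ range n, (f (x (s + t)) - ∫ z, f z ∂π)) ^ 2
        ∂(Kernel.trajMeasure (X := fun _ : ℕ => S) μ₀
        (fun n : ℕ => κ.comap (fun h : (i : ↥(Finset.Iic n)) → S => h ⟨n, Finset.mem_Iic.2 le_rfl⟩)
          (measurable_pi_apply _)))
      ≤ (2 * C) ^ 2 * (2 + 4 * m / ε.toReal) * n := by
  set P := Kernel.trajMeasure (X := fun _ : ℕ => S) μ₀
      (fun n : ℕ => κ.comap (fun h : (i : ↥(Finset.Iic n)) → S => h ⟨n, Finset.mem_Iic.2 le_rfl⟩)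
        (measurable_pi_apply _)) with hP
  have hεtop : ε ≠ ∞ := ne_top_of_le_ne_top ENNReal.one_ne_top hε1
  have hεpos : 0 < ε.toReal := ENNReal.toReal_pos hε0.ne' hεtop
  have hr0 : 0 ≤ 1 - ε.toReal :=
    sub_nonneg.2 (ENNReal.toReal_le_of_le_ofReal zero_le_one (by simpa using hε1))
  have hr1 : 1 - ε.toReal < 1 := sub_lt_self _ hεpos
  obtain ⟨hfb, hCfb, -⟩ := Scoring.centred_observable_bounds π hf hC
  set c := ∫ z, f z ∂π with hc
  have hC0 : 0 ≤ 2 * C := by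
    have := (abs_nonneg _).trans (hCfb (Classical.choice (nonempty_of_isProbabilityMeasure μ₀)))
    linarith
  -- expand the square into a double sum of two-time products
  have hint : ∀ i j, Integrable (fun x : ℕ → S => (f (x i) - c) * (f (x j) - c)) P := fun i j =>
    Scoring.integrable_of_bounded P ((hfb.comp (measurable_pi_apply i)).mul
      (hfb.comp (measurable_pi_apply j))) (C := 2 * C * (2 * C)) fun x => by
        rw [abs_mul]; exact mul_le_mul (hCfb _) (hCfb _) (abs_nonneg _) hC0
  have hexp : ∫ x, (∑ t ∈ range n, (f (x (s + t)) - c)) ^ 2 ∂P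
      = ∑ i ∈ range n, ∑ j ∈ range n, ∫ x, (f (x (s + i)) - c) * (f (x (s + j)) - c) ∂P := by
    have hpt : ∀ x : ℕ → S, (∑ t ∈ range n, (f (x (s + t)) - c)) ^ 2
        = ∑ i ∈ range n, ∑ j ∈ range n, (f (x (s + i)) - c) * (f (x (s + j)) - c) := fun x => by
      rw [sq, Finset.sum_mul_sum]
    rw [integral_congr_ae (ae_of_all _ hpt),
      integral_finsetSum _ fun i _ => integrable_finsetSum _ fun j _ => hint _ _]
    exact Finset.sum_congr rfl fun i _ => integral_finsetSum _ fun j _ => hint _ _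
  rw [hexp]
  -- bound each term by the lag envelope
  have hterm : ∀ i ∈ range n, ∀ j ∈ range n,
      ∫ x, (f (x (s + i)) - c) * (f (x (s + j)) - c) ∂P
        ≤ 2 * (2 * C) ^ 2 * (1 - ε.toReal) ^ (Nat.dist i j / m) := by
    intro i _ j _
    refine (le_abs_self _).trans ?_
    rcases le_total i j with hij | hji
    · have h := abs_chain_centred_pair_le_of_nHit μ₀ hmin hε1 hπ hf hC (Nat.add_le_add_left hij s)
      rw [← hP, Nat.add_sub_add_left] at h
      rwa [Nat.dist_eq_sub_of_le hij]
    · have h := abs_chain_centred_pair_le_of_nHit μ₀ hmin hε1 hπ hf hC (Nat.add_le_add_left hji s)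
      rw [← hP, Nat.add_sub_add_left] at h
      rw [Nat.dist_eq_sub_of_le_right hji]
      have hcomm : (fun x : ℕ → S => (f (x (s + i)) - c) * (f (x (s + j)) - c))
          = fun x => (f (x (s + j)) - c) * (f (x (s + i)) - c) := by funext x; ring
      rwa [hcomm]
  calc ∑ i ∈ range n, ∑ j ∈ range n, ∫ x, (f (x (s + i)) - c) * (f (x (s + j)) - c) ∂P
      ≤ ∑ i ∈ range n, ∑ j ∈ range n, 2 * (2 * C) ^ 2 * (1 - ε.toReal) ^ (Nat.dist i j / m) :=
        Finset.sum_le_sum fun i hi => Finset.sum_le_sum fun j hj => hterm i hi j hj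
    _ = n * (2 * (2 * C) ^ 2 * (1 - ε.toReal) ^ (0 / m))
        + 2 * ∑ t ∈ range n, ((n : ℝ) - (t + 1)) * (2 * (2 * C) ^ 2 * (1 - ε.toReal) ^ ((t + 1) / m)) :=
        Scoring.sum_sum_dist (fun d => 2 * (2 * C) ^ 2 * (1 - ε.toReal) ^ (d / m)) n
    _ ≤ n * (2 * (2 * C) ^ 2) + 2 * ∑ t ∈ range n, (n : ℝ) * (2 * (2 * C) ^ 2 * (1 - ε.toReal) ^ ((t + 1) / m)) := by
        rw [Nat.zero_div, pow_zero, mul_one]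
        refine add_le_add le_rfl (mul_le_mul_of_nonneg_left (Finset.sum_le_sum fun t ht => ?_)
          (by norm_num))
        refine mul_le_mul_of_nonneg_right (by linarith [(Nat.cast_nonneg t : (0 : ℝ) ≤ t)]) ?_
        positivity
    _ = n * (2 * (2 * C) ^ 2) * (1 + 2 * ∑ t ∈ range n, (1 - ε.toReal) ^ ((t + 1) / m)) := by
        rw [← Finset.mul_sum, ← Finset.mul_sum]; ring
    _ ≤ n * (2 * (2 * C) ^ 2) * (1 + 2 * (m / ε.toReal)) := by
        refine mul_le_mul_of_nonneg_left (add_le_add le_rfl (mul_le_mul_of_nonneg_left ?_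
          (by norm_num))) (by positivity)
        calc ∑ t ∈ range n, (1 - ε.toReal) ^ ((t + 1) / m)
            ≤ ∑ t ∈ range n, (1 - ε.toReal) ^ (t / m) := Finset.sum_le_sum fun t _ =>
              pow_le_pow_of_le_one hr0 hr1.le (Nat.div_le_div_right (Nat.le_succ t))
          _ ≤ m / (1 - (1 - ε.toReal)) := Scoring.sum_range_pow_div_le hm hr0 hr1 n
          _ = m / ε.toReal := by rw [sub_sub_cancel]
    _ = (2 * C) ^ 2 * (2 + 4 * m / ε.toReal) * n := by ring

end BlockSum

/-! ## Lag products `A_t = g(X_t) g(X_{t+k})` -/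

section LagProduct

variable {κ : Kernel S S} [IsMarkovKernel κ] {ν : Measure S} [IsProbabilityMeasure ν] {ε : ℝ≥0∞}
  {π : Measure S} [IsProbabilityMeasure π] {m : ℕ} (μ₀ : Measure S) [IsProbabilityMeasure μ₀]

/-- **Bias of a lag product from any start**: `|E_{μ₀}[g(X_t) g(X_{t+k})] − autocov κ π g k| ≤
2 C_g² (1 − ε)^{⌊t/m⌋}`. -/
theorem abs_chain_lagProduct_sub_autocov_le_of_nHit
    (hmin : ∀ x {B : Set S}, MeasurableSet B → ε * ν B ≤ nHit κ m x B) (hε1 : ε ≤ 1)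
    (hπ : Kernel.Invariant κ π) {g : S → ℝ} (hg : Measurable g) {Cg : ℝ} (hCg : ∀ x, |g x| ≤ Cg)
    (t k : ℕ) :
    |∫ x, g (x t) * g (x (t + k)) ∂(Kernel.trajMeasure (X := fun _ : ℕ => S) μ₀
        (fun n : ℕ => κ.comap (fun h : (i : ↥(Finset.Iic n)) → S => h ⟨n, Finset.mem_Iic.2 le_rfl⟩)
          (measurable_pi_apply _))) - Scoring.autocov κ π g k| ≤ 2 * Cg ^ 2 * (1 - ε.toReal) ^ (t / m) := by
  set P := Kernel.trajMeasure (X := fun _ : ℕ => S) μ₀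
      (fun n : ℕ => κ.comap (fun h : (i : ↥(Finset.Iic n)) → S => h ⟨n, Finset.mem_Iic.2 le_rfl⟩)
        (measurable_pi_apply _)) with hP
  have hCg0 : 0 ≤ Cg := (abs_nonneg _).trans (hCg (Classical.choice
    (nonempty_of_isProbabilityMeasure μ₀)))
  have h := chain_dependsOn_centredFuturePair_le_of_nHit μ₀ hmin hε1 hπ 0 t k (G := fun _ => (1 : ℝ))
    measurable_const ((dependsOn_const (1 : ℝ)).mono (Set.empty_subset _)) (CG := 1)
    (fun _ => by simp) hg hCg hg hCg
  rw [← hP] at h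
  simp only [one_mul, Nat.zero_add, abs_one, integral_const, probReal_univ, smul_eq_mul,
    mul_one] at h
  have hi : Integrable (fun x : ℕ → S => g (x t) * g (x (t + k))) P :=
    Scoring.integrable_of_bounded P ((hg.comp (measurable_pi_apply _)).mul
      (hg.comp (measurable_pi_apply _))) (C := Cg * Cg) fun x => by
        rw [abs_mul]; exact mul_le_mul (hCg _) (hCg _) (abs_nonneg _) hCg0
  rw [integral_sub hi (integrable_const _), integral_const, probReal_univ, one_smul] at h
  unfold Scoring.autocov
  rw [sq]
  exact h

/-- **Covariance envelope of lag products, ALL pairs of times**: with `A_t = g(X_t) g(X_{t+k})` and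
`B_t = A_t − E_{μ₀} A_t`: `|E_{μ₀}[B_s B_t]| ≤ 4 C_g⁴ (1 − ε)^{⌊(dist(s,t) − k)/m⌋}` (natural-number
subtraction: within the overlap window `dist(s,t) < k` the exponent is `0` and the bound is the crude
`4 C_g⁴`). -/
theorem abs_chain_lagProduct_cov_le_of_nHit
    (hmin : ∀ x {B : Set S}, MeasurableSet B → ε * ν B ≤ nHit κ m x B) (hε1 : ε ≤ 1)
    (hπ : Kernel.Invariant κ π) {g : S → ℝ} (hg : Measurable g) {Cg : ℝ} (hCg : ∀ x, |g x| ≤ Cg)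
    (k s t : ℕ) :
    |∫ x, (g (x s) * g (x (s + k)) - ∫ x', g (x' s) * g (x' (s + k))
          ∂(Kernel.trajMeasure (X := fun _ : ℕ => S) μ₀
            (fun n : ℕ => κ.comap (fun h : (i : ↥(Finset.Iic n)) → S => h ⟨n, Finset.mem_Iic.2 le_rfl⟩)
              (measurable_pi_apply _))))
        * (g (x t) * g (x (t + k)) - ∫ x', g (x' t) * g (x' (t + k))
          ∂(Kernel.trajMeasure (X := fun _ : ℕ => S) μ₀
            (fun n : ℕ => κ.comap (fun h : (i : ↥(Finset.Iic n)) → S => h ⟨n, Finset.mem_Iic.2 le_rfl⟩)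
              (measurable_pi_apply _))))
        ∂(Kernel.trajMeasure (X := fun _ : ℕ => S) μ₀
        (fun n : ℕ => κ.comap (fun h : (i : ↥(Finset.Iic n)) → S => h ⟨n, Finset.mem_Iic.2 le_rfl⟩)
          (measurable_pi_apply _)))|
      ≤ 4 * Cg ^ 4 * (1 - ε.toReal) ^ ((Nat.dist s t - k) / m) := by
  set P := Kernel.trajMeasure (X := fun _ : ℕ => S) μ₀
      (fun n : ℕ => κ.comap (fun h : (i : ↥(Finset.Iic n)) → S => h ⟨n, Finset.mem_Iic.2 le_rfl⟩)
        (measurable_pi_apply _)) with hP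
  have hCg0 : 0 ≤ Cg := (abs_nonneg _).trans (hCg (Classical.choice
    (nonempty_of_isProbabilityMeasure μ₀)))
  have hr0 : 0 ≤ 1 - ε.toReal :=
    sub_nonneg.2 (ENNReal.toReal_le_of_le_ofReal zero_le_one (by simpa using hε1))
  have hr1 : 1 - ε.toReal ≤ 1 := sub_le_self _ ENNReal.toReal_nonneg
  -- the lag products and their centred versions
  have hAm : ∀ u, Measurable fun x : ℕ → S => g (x u) * g (x (u + k)) := fun u =>
    (hg.comp (measurable_pi_apply _)).mul (hg.comp (measurable_pi_apply _))
  have hAb : ∀ u (x : ℕ → S), |g (x u) * g (x (u + k))| ≤ Cg * Cg := fun u x => by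
    rw [abs_mul]; exact mul_le_mul (hCg _) (hCg _) (abs_nonneg _) hCg0
  have hEb : ∀ u, |∫ x', g (x' u) * g (x' (u + k)) ∂P| ≤ Cg * Cg := fun u => by
    calc |∫ x', g (x' u) * g (x' (u + k)) ∂P| = ‖∫ x', g (x' u) * g (x' (u + k)) ∂P‖ :=
          (Real.norm_eq_abs _).symm
      _ ≤ Cg * Cg * P.real univ := norm_integral_le_of_norm_le_const (Eventually.of_forall fun x => by
          rw [Real.norm_eq_abs]; exact hAb u x)
      _ = Cg * Cg := by rw [probReal_univ, mul_one]
  have hBm : ∀ u, Measurable fun x : ℕ → S =>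
      g (x u) * g (x (u + k)) - ∫ x', g (x' u) * g (x' (u + k)) ∂P := fun u =>
    (hAm u).sub measurable_const
  have hBb : ∀ u (x : ℕ → S), |g (x u) * g (x (u + k)) - ∫ x', g (x' u) * g (x' (u + k)) ∂P|
      ≤ 2 * (Cg * Cg) := fun u x =>
    (abs_sub _ _).trans (by linarith [hAb u x, hEb u])
  have hBd : ∀ u, DependsOn (fun x : ℕ → S =>
      g (x u) * g (x (u + k)) - ∫ x', g (x' u) * g (x' (u + k)) ∂P) (Set.Iic (u + k)) := by
    intro u x y hxy
    simp only [hxy u (Set.mem_Iic.2 (Nat.le_add_right u k)), hxy (u + k) (Set.mem_Iic.2 le_rfl)]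
  have hB0 : ∀ u, ∫ x, (g (x u) * g (x (u + k)) - ∫ x', g (x' u) * g (x' (u + k)) ∂P) ∂P = 0 := by
    intro u
    rw [integral_sub (Scoring.integrable_of_bounded P (hAm u) (hAb u)) (integrable_const _),
      integral_const, probReal_univ, one_smul, sub_self]
  -- the crude bound, valid for all pairs
  have hcrude : ∀ u v, |∫ x, (g (x u) * g (x (u + k)) - ∫ x', g (x' u) * g (x' (u + k)) ∂P)
      * (g (x v) * g (x (v + k)) - ∫ x', g (x' v) * g (x' (v + k)) ∂P) ∂P| ≤ 4 * Cg ^ 4 := by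
    intro u v
    calc |∫ x, (g (x u) * g (x (u + k)) - ∫ x', g (x' u) * g (x' (u + k)) ∂P)
          * (g (x v) * g (x (v + k)) - ∫ x', g (x' v) * g (x' (v + k)) ∂P) ∂P|
        = ‖∫ x, (g (x u) * g (x (u + k)) - ∫ x', g (x' u) * g (x' (u + k)) ∂P)
          * (g (x v) * g (x (v + k)) - ∫ x', g (x' v) * g (x' (v + k)) ∂P) ∂P‖ :=
          (Real.norm_eq_abs _).symm
      _ ≤ 2 * (Cg * Cg) * (2 * (Cg * Cg)) * P.real univ :=
          norm_integral_le_of_norm_le_const (Eventually.of_forall fun x => by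
            rw [Real.norm_eq_abs, abs_mul]
            exact mul_le_mul (hBb u x) (hBb v x) (abs_nonneg _) (by positivity))
      _ = 4 * Cg ^ 4 := by rw [probReal_univ, mul_one]; ring
  -- the decorrelated bound for `u + k ≤ v`
  have hfar : ∀ u v, u + k ≤ v → |∫ x, (g (x u) * g (x (u + k)) - ∫ x', g (x' u) * g (x' (u + k)) ∂P)
      * (g (x v) * g (x (v + k)) - ∫ x', g (x' v) * g (x' (v + k)) ∂P) ∂P|
      ≤ 4 * Cg ^ 4 * (1 - ε.toReal) ^ ((v - u - k) / m) := by
    intro u v huv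
    obtain ⟨w, hw⟩ := Nat.exists_eq_add_of_le huv
    -- `E[B_u B_v] = E[B_u (A_v − C_g(k))]` since `E B_u = 0`
    have hiB : Integrable (fun x : ℕ → S =>
        g (x u) * g (x (u + k)) - ∫ x', g (x' u) * g (x' (u + k)) ∂P) P :=
      Scoring.integrable_of_bounded P (hBm u) (hBb u)
    have hiBA : Integrable (fun x : ℕ → S =>
        (g (x u) * g (x (u + k)) - ∫ x', g (x' u) * g (x' (u + k)) ∂P)
          * (g (x v) * g (x (v + k))) ) P :=
      Scoring.integrable_of_bounded P ((hBm u).mul (hAm v)) (C := 2 * (Cg * Cg) * (Cg * Cg))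
        fun x => by rw [abs_mul]; exact mul_le_mul (hBb u x) (hAb v x) (abs_nonneg _) (by positivity)
    have hrew : ∫ x, (g (x u) * g (x (u + k)) - ∫ x', g (x' u) * g (x' (u + k)) ∂P)
        * (g (x v) * g (x (v + k)) - ∫ x', g (x' v) * g (x' (v + k)) ∂P) ∂P
        = ∫ x, (g (x u) * g (x (u + k)) - ∫ x', g (x' u) * g (x' (u + k)) ∂P)
          * (g (x (u + k + w)) * g (x (u + k + w + k)) - Scoring.autocov κ π g k) ∂P := by
      have e1 : (fun x : ℕ → S => (g (x u) * g (x (u + k)) - ∫ x', g (x' u) * g (x' (u + k)) ∂P)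
          * (g (x v) * g (x (v + k)) - ∫ x', g (x' v) * g (x' (v + k)) ∂P))
          = fun x => (g (x u) * g (x (u + k)) - ∫ x', g (x' u) * g (x' (u + k)) ∂P)
            * (g (x v) * g (x (v + k)))
            - (g (x u) * g (x (u + k)) - ∫ x', g (x' u) * g (x' (u + k)) ∂P)
              * ∫ x', g (x' v) * g (x' (v + k)) ∂P := by funext x; ring
      have e2 : (fun x : ℕ → S => (g (x u) * g (x (u + k)) - ∫ x', g (x' u) * g (x' (u + k)) ∂P)
          * (g (x (u + k + w)) * g (x (u + k + w + k)) - Scoring.autocov κ π g k))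
          = fun x => (g (x u) * g (x (u + k)) - ∫ x', g (x' u) * g (x' (u + k)) ∂P)
            * (g (x v) * g (x (v + k)))
            - (g (x u) * g (x (u + k)) - ∫ x', g (x' u) * g (x' (u + k)) ∂P)
              * Scoring.autocov κ π g k := by
        funext x; rw [hw]; ring
      rw [e1, e2, integral_sub hiBA (hiB.mul_const _), integral_sub hiBA (hiB.mul_const _),
        integral_mul_const, integral_mul_const, hB0 u, zero_mul, zero_mul]
    rw [hrew]
    have h := chain_dependsOn_centredFuturePair_le_of_nHit μ₀ hmin hε1 hπ (u + k) w k (hBm u) (hBd u)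
      (hBb u) hg hCg hg hCg
    rw [← hP] at h
    unfold Scoring.autocov
    refine h.trans ?_
    have hI : ∫ x, |g (x u) * g (x (u + k)) - ∫ x', g (x' u) * g (x' (u + k)) ∂P| ∂P ≤ 2 * (Cg * Cg) := by
      calc ∫ x, |g (x u) * g (x (u + k)) - ∫ x', g (x' u) * g (x' (u + k)) ∂P| ∂P
          = ‖∫ x, |g (x u) * g (x (u + k)) - ∫ x', g (x' u) * g (x' (u + k)) ∂P| ∂P‖ := by
            rw [Real.norm_eq_abs, abs_of_nonneg (integral_nonneg fun x => abs_nonneg _)]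
        _ ≤ 2 * (Cg * Cg) * P.real univ := norm_integral_le_of_norm_le_const
            (Eventually.of_forall fun x => by rw [Real.norm_eq_abs, abs_abs]; exact hBb u x)
        _ = 2 * (Cg * Cg) := by rw [probReal_univ, mul_one]
    have hvw : v - u - k = w := by omega
    rw [hvw]
    calc 2 * (Cg * Cg) * (1 - ε.toReal) ^ (w / m)
          * ∫ x, |g (x u) * g (x (u + k)) - ∫ x', g (x' u) * g (x' (u + k)) ∂P| ∂P
        ≤ 2 * (Cg * Cg) * (1 - ε.toReal) ^ (w / m) * (2 * (Cg * Cg)) :=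
          mul_le_mul_of_nonneg_left hI (by positivity)
      _ = 4 * Cg ^ 4 * (1 - ε.toReal) ^ (w / m) := by ring
  -- case analysis on the distance
  by_cases hk : Nat.dist s t < k
  · rw [Nat.sub_eq_zero_of_le hk.le, Nat.zero_div, pow_zero, mul_one]
    exact hcrude s t
  · rw [not_lt] at hk
    rcases le_total s t with hst | hts
    · rw [Nat.dist_eq_sub_of_le hst] at hk ⊢
      exact hfar s t (by omega)
    · rw [Nat.dist_eq_sub_of_le_right hts] at hk ⊢
      have hcomm : (fun x : ℕ → S => (g (x s) * g (x (s + k)) - ∫ x', g (x' s) * g (x' (s + k)) ∂P)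
          * (g (x t) * g (x (t + k)) - ∫ x', g (x' t) * g (x' (t + k)) ∂P))
          = fun x => (g (x t) * g (x (t + k)) - ∫ x', g (x' t) * g (x' (t + k)) ∂P)
            * (g (x s) * g (x (s + k)) - ∫ x', g (x' s) * g (x' (s + k)) ∂P) := by
        funext x; ring
      rw [hcomm]
      exact hfar t s (by omega)

end LagProduct

end Summit.Ventures.LatticeQCDFlow.Exactness.GeneralNCMC
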